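import Literature.NumberTheory.ConnesMoscovici2022.UVProlateDeficiencyEndpoints
import HarnessLib

/-!
# Connes–Moscovici 2022, §1: solution pairs for the Green's kernel of `W − z` on the three
# components (regular at the singular end points `±λ`, non-degenerate Wronskian)

LINE 1 — FRAMING. RH-FREE corpus literature (spectral theory of the prolate wave operator
`W_λ = −∂(λ² − x²)∂ + (2πλx)²` on `L²(ℝ)`; sequel row O2 of the Connes–Consani corpus, no leaf / binder
role).  bears_on: LADDER-RH W-C/W-P.  WHAT THIS IS NOT: any claim about RH; nothing in this file
mentions `RiemannHypothesis` or bears on the truth of RH.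

Theorems-only companion of `UVProlateSpectrum.lean`: the ODE input of the COMPACT-RESOLVENT clause of
[ConnesMoscovici2022, Thm 1.6 (iv)] ("The spectrum of `W_sa` is discrete …", = arXiv:2112.05500
Thm 2.6 (iv)), obtained in this tree by the route "Hilbert–Schmidt right inverse of `W_max − z` +
finite deficiency" (`Literature.Analysis.UnboundedOperators.isCompactOperator_resolvent_of_rightInverse`,
with `dim Ker(W_max − z) = 4` from `UVProlateDeficiencyIndices`).  The right inverse is the
variation-of-parameters (Green's kernel) operator `f ↦ −ω_J⁻¹ (v_J(x) ∫_{y<x} u_J f + u_J(x) ∫_{y>x} v_J f)`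
on each component `J` of `ℝ ∖ {±λ}`, and THIS FILE supplies the solution pairs `(u_J, v_J)` of
`((λ² − x²) g′)′ = ((2πλx)² − z) g` it needs, from the a-priori endpoint package
`UVProlateDeficiencyEndpoints` (rh-crit-cc-t10: all four finite singular points are limit circle)
and the classical existence/uniqueness theory `UVProlateDeficiencyODE` (rh-crit-cc-t8):

* `exists_greenPair_Ioi` — on `(λ, ∞)`: `u` REGULAR at `λ⁺` (`(λ² − x²) u′ → 0`), `v` with non-zero
  logarithmic coefficient, and constant NON-ZERO Wronskian `u (p v′) − v (p u′) = ω`;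
* `exists_greenPair_Iio` — on `(−∞, −λ)`: `v` regular at `(−λ)⁻`, `u` with non-zero coefficient;
* `sol_Ioo_eq_zero_of_tendsto_zero` — on `(−λ, λ)`, for `Im z ≠ 0`, a solution with
  `(λ² − x²) g′ → 0` at BOTH `±λ` vanishes identically (Green's formula for `ḡ · p g′`, imaginary
  part: `Im z ∫ |g|² = 0`) — i.e. `z` is not an eigenvalue of the Legendre-type operator on `[−λ, λ]`;
* `exists_greenPair_Ioo` — on `(−λ, λ)`, for `Im z ≠ 0`: `u` regular at `(−λ)⁺`, `v` regular at
  `λ⁻`, non-zero constant Wronskian.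

0 `def`s, 0 named facts, no `sorry`.

## References
* [ConnesMoscovici2022] A. Connes, H. Moscovici, *The UV prolate spectrum matches the zeros of zeta*,
  PNAS 119 (2022) = arXiv:2112.05500, §1 eqs. (1.5)–(1.6), Lemma 1.1, Thm 1.6 (held text
  `paper-arxiv-2112.05500`, chunks p0004–p0006).
* [ReedSimonIV1978] M. Reed, B. Simon, *Methods of Modern Mathematical Physics IV* (1978), §XIII.14.
-/

noncomputable section

open Complex Set MeasureTheory Filter
open scoped Real Topology ComplexConjugate

namespace Literature.NumberTheory.ConnesMoscovici2022

variable {lam : ℝ} {z : ℂ}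

/-! ## §1 Two-dimensional bookkeeping: data at a base point, collinearity -/

/-- If a solution pair on a set containing `x₀` has the same data `(g(x₀), p(x₀)g′(x₀))` as the
combination `t • h`, it IS `t • h` there (uniqueness on the three components is quoted from
`UVProlateDeficiencyODE`; this lemma is the collinearity step: a `2 × 2` determinant vanishes and the
first column is non-zero). [folklore] -/
private theorem exists_smul_of_det_eq_zero {a₁ b₁ a₂ b₂ : ℂ} (h : a₁ * b₂ - a₂ * b₁ = 0)
    (hne : a₁ ≠ 0 ∨ b₁ ≠ 0) : ∃ t : ℂ, a₂ = t * a₁ ∧ b₂ = t * b₁ := by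
  rcases hne with ha | hb
  · refine ⟨a₂ / a₁, by field_simp, ?_⟩
    field_simp
    linear_combination h
  · refine ⟨b₂ / b₁, ?_, by field_simp⟩
    field_simp
    linear_combination -h

/-! ## §2 The component `(λ, ∞)` -/

section Ioi

/-- **A solution regular at `λ⁺`.**  On `(λ, ∞)` there is a classical solution pair `(u, u′)` of
`((λ² − x²) g′)′ = ((2πλx)² − z) g` whose logarithmic coefficient VANISHES,
`(λ² − x²) u′(x) → 0` as `x → λ⁺`, with non-trivial data at `x₀ = λ + 1/2`
(so `u ≢ 0`): from two solutions with data `(1,0)`, `(0,1)` and coefficients `c₁, c₂`, take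
`u = c₂ g₁ − c₁ g₂`; `(c₁, c₂) ≠ 0` by `exists_sol_Ioi_tendsto_ne_zero`.
[cite: ConnesMoscovici2022, Lemma 1.1 (= arXiv:2112.05500 Lemma 2.1, chunk p0004:L39–L48); §1 (1.19)] -/
theorem exists_sol_Ioi_tendsto_zero (hlam : 0 < lam) (z : ℂ) :
    ∃ u u' : ℝ → ℂ, (∀ x ∈ Ioi lam, HasDerivAt u (u' x) x ∧
        HasDerivAt (fun y ↦ pCoeff lam y * u' y) ((qCoeff lam x - z) * u x) x) ∧
      Tendsto (fun x ↦ pCoeff lam x * u' x) (𝓝[>] lam) (𝓝 0) ∧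
      (u (lam + 1 / 2) ≠ 0 ∨ pCoeff lam (lam + 1 / 2) * u' (lam + 1 / 2) ≠ 0) := by
  have hx₀ : lam < lam + 1 / 2 := by linarith
  obtain ⟨g₁, g₁', h10, h11, hs₁⟩ := exists_sol_Ioi hlam z hx₀ 1 0
  obtain ⟨g₂, g₂', h20, h21, hs₂⟩ := exists_sol_Ioi hlam z hx₀ 0 1
  obtain ⟨⟨c₁, hc₁⟩, -, -⟩ := prolate_singularEndpoint_right hlam z (fun x hx ↦ (hs₁ x hx).1)
    (fun x hx ↦ (hs₁ x hx).2)
  obtain ⟨⟨c₂, hc₂⟩, -, -⟩ := prolate_singularEndpoint_right hlam z (fun x hx ↦ (hs₂ x hx).1)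
    (fun x hx ↦ (hs₂ x hx).2)
  -- `(c₁, c₂) ≠ 0`: the non-degenerate solution `w` is `w(x₀) g₁ + (p w′)(x₀) g₂`
  have hne : c₁ ≠ 0 ∨ c₂ ≠ 0 := by
    obtain ⟨w, w', hsw, c, hc, hwc⟩ := exists_sol_Ioi_tendsto_ne_zero hlam z
    obtain ⟨hl₁, hl₂⟩ := sol_linear_comb (w (lam + 1 / 2)) (pCoeff lam (lam + 1 / 2) * w' (lam + 1 / 2))
      (fun x hx ↦ (hs₁ x hx).1) (fun x hx ↦ (hs₁ x hx).2)
      (fun x hx ↦ (hs₂ x hx).1) (fun x hx ↦ (hs₂ x hx).2)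
    have hd0 : w (lam + 1 / 2) = w (lam + 1 / 2) * g₁ (lam + 1 / 2) + pCoeff lam (lam + 1 / 2) * w' (lam + 1 / 2) * g₂ (lam + 1 / 2) := by
      rw [h10, h20]; ring
    have hd1 : pCoeff lam (lam + 1 / 2) * w' (lam + 1 / 2) =
        pCoeff lam (lam + 1 / 2) * (w (lam + 1 / 2) * g₁' (lam + 1 / 2) + pCoeff lam (lam + 1 / 2) * w' (lam + 1 / 2) * g₂' (lam + 1 / 2)) := by
      have e : pCoeff lam (lam + 1 / 2) * (w (lam + 1 / 2) * g₁' (lam + 1 / 2) + pCoeff lam (lam + 1 / 2) * w' (lam + 1 / 2) * g₂' (lam + 1 / 2)) =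
          w (lam + 1 / 2) * (pCoeff lam (lam + 1 / 2) * g₁' (lam + 1 / 2)) +
            pCoeff lam (lam + 1 / 2) * w' (lam + 1 / 2) * (pCoeff lam (lam + 1 / 2) * g₂' (lam + 1 / 2)) := by ring
      rw [e, h11, h21]; ring
    have heq := eqOn_of_sol_Ioi hlam hx₀ (fun x hx ↦ (hsw x hx).1) (fun x hx ↦ (hsw x hx).2)
      hl₁ hl₂ hd0 hd1
    set a : ℂ := w (lam + 1 / 2) with ha
    set b : ℂ := pCoeff lam (lam + 1 / 2) * w' (lam + 1 / 2) with hb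
    -- the coefficient of `w` is `a c₁ + b c₂`
    have hlim : Tendsto (fun x ↦ pCoeff lam x * w' x) (𝓝[>] lam) (𝓝 (a * c₁ + b * c₂)) := by
      have h := (hc₁.const_mul a).add (hc₂.const_mul b)
      refine h.congr' ?_
      filter_upwards [self_mem_nhdsWithin] with x hx
      rw [heq.2 hx]; ring
    have hc' : a * c₁ + b * c₂ = c := tendsto_nhds_unique hlim hwc
    by_contra h0
    push Not at h0
    rw [h0.1, h0.2] at hc'
    exact hc (by rw [← hc']; ring)
  obtain ⟨hu₁, hu₂⟩ := sol_linear_comb c₂ (-c₁) (fun x hx ↦ (hs₁ x hx).1) (fun x hx ↦ (hs₁ x hx).2)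
    (fun x hx ↦ (hs₂ x hx).1) (fun x hx ↦ (hs₂ x hx).2)
  refine ⟨fun y ↦ c₂ * g₁ y + -c₁ * g₂ y, fun y ↦ c₂ * g₁' y + -c₁ * g₂' y,
    fun x hx ↦ ⟨hu₁ x hx, hu₂ x hx⟩, ?_, ?_⟩
  · have h := (hc₁.const_mul c₂).add (hc₂.const_mul (-c₁))
    rw [show c₂ * c₁ + -c₁ * c₂ = 0 by ring] at h
    refine h.congr' (Eventually.of_forall fun x ↦ ?_)
    simp only; ring
  · simp only [h10, h20, mul_one, mul_zero, add_zero]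
    rw [mul_add, ← mul_assoc, mul_comm (pCoeff lam _) c₂, mul_assoc, h11, ← mul_assoc,
      mul_comm (pCoeff lam _) (-c₁), mul_assoc, h21]
    simp only [mul_zero, zero_add, mul_one, ne_eq, neg_eq_zero]
    tauto

/-- **The Green pair on `(λ, ∞)`.**  There are classical solution pairs `(u, u′)`, `(v, v′)` of
`((λ² − x²) g′)′ = ((2πλx)² − z) g` on `(λ, ∞)` with `u` REGULAR at `λ⁺` (`(λ² − x²)u′ → 0`), `v`
of NON-ZERO logarithmic coefficient (`(λ² − x²)v′ → c ≠ 0`), and constant non-zero Wronskian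
`u (p v′) − v (p u′) ≡ ω ≠ 0` — the two solutions entering the Green's kernel
`−ω⁻¹ u(x ∧ y) v(x ∨ y)` of `W − z` on this component (every solution is `L²` on `(λ, ∞)`:
`prolate_sq_integrableOn_Ioi_lam`).
[cite: ConnesMoscovici2022, Lemma 1.1 and Thm 1.6 (iv) (= arXiv:2112.05500 Lemma 2.1, Thm 2.6 (iv), chunks p0004:L39–L48, p0006:L79); §1 (1.5)–(1.6)] -/
theorem exists_greenPair_Ioi (hlam : 0 < lam) (z : ℂ) :
    ∃ u u' v v' : ℝ → ℂ, ∃ ω c : ℂ, ω ≠ 0 ∧ c ≠ 0 ∧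
      (∀ x ∈ Ioi lam, HasDerivAt u (u' x) x ∧
        HasDerivAt (fun y ↦ pCoeff lam y * u' y) ((qCoeff lam x - z) * u x) x) ∧
      (∀ x ∈ Ioi lam, HasDerivAt v (v' x) x ∧
        HasDerivAt (fun y ↦ pCoeff lam y * v' y) ((qCoeff lam x - z) * v x) x) ∧
      Tendsto (fun x ↦ pCoeff lam x * u' x) (𝓝[>] lam) (𝓝 0) ∧
      Tendsto (fun x ↦ pCoeff lam x * v' x) (𝓝[>] lam) (𝓝 c) ∧
      ∀ x ∈ Ioi lam, u x * (pCoeff lam x * v' x) - v x * (pCoeff lam x * u' x) = ω := by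
  obtain ⟨u, u', hsu, hu0, hune⟩ := exists_sol_Ioi_tendsto_zero hlam z
  obtain ⟨v, v', hsv, c, hc, hvc⟩ := exists_sol_Ioi_tendsto_ne_zero hlam z
  set x₀ : ℝ := lam + 1 / 2 with hx₀def
  have hx₀ : lam < x₀ := by rw [hx₀def]; linarith
  set ω : ℂ := u x₀ * (pCoeff lam x₀ * v' x₀) - v x₀ * (pCoeff lam x₀ * u' x₀) with hω
  -- the Wronskian is constant
  have hW : ∀ x ∈ Ioi lam, u x * (pCoeff lam x * v' x) - v x * (pCoeff lam x * u' x) = ω := by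
    intro x hx
    set b : ℝ := max x x₀ + 1
    have hsub : Ioo lam b ⊆ Ioi lam := fun y hy ↦ hy.1
    have hxb : x ∈ Ioo lam b := ⟨hx, by simp only [b]; linarith [le_max_left x x₀]⟩
    have hx₀b : x₀ ∈ Ioo lam b := ⟨hx₀, by simp only [b]; linarith [le_max_right x x₀]⟩
    exact wronskian_sol_eq (fun y hy ↦ (hsu y (hsub hy)).1) (fun y hy ↦ (hsu y (hsub hy)).2)
      (fun y hy ↦ (hsv y (hsub hy)).1) (fun y hy ↦ (hsv y (hsub hy)).2) hxb hx₀b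
  refine ⟨u, u', v, v', ω, c, ?_, hc, hsu, hsv, hu0, hvc, hW⟩
  -- `ω ≠ 0`: otherwise `v = t u` and the coefficient of `v` would vanish
  intro hω0
  obtain ⟨t, hta, htb⟩ := exists_smul_of_det_eq_zero (a₁ := u x₀) (b₁ := pCoeff lam x₀ * u' x₀)
    (a₂ := v x₀) (b₂ := pCoeff lam x₀ * v' x₀) (by rw [hω] at hω0; exact hω0) hune
  obtain ⟨hl₁, hl₂⟩ := sol_linear_comb t 0 (fun x hx ↦ (hsu x hx).1) (fun x hx ↦ (hsu x hx).2)
    (fun x hx ↦ (hsu x hx).1) (fun x hx ↦ (hsu x hx).2)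
  have hd0 : v x₀ = t * u x₀ + 0 * u x₀ := by rw [hta]; ring
  have hd1 : pCoeff lam x₀ * v' x₀ = pCoeff lam x₀ * (t * u' x₀ + 0 * u' x₀) := by rw [htb]; ring
  have heq := eqOn_of_sol_Ioi hlam hx₀ (fun x hx ↦ (hsv x hx).1) (fun x hx ↦ (hsv x hx).2) hl₁ hl₂
    hd0 hd1
  have hlim : Tendsto (fun x ↦ pCoeff lam x * v' x) (𝓝[>] lam) (𝓝 (t * 0)) := by
    refine (hu0.const_mul t).congr' ?_
    filter_upwards [self_mem_nhdsWithin] with x hx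
    rw [heq.2 hx]; ring
  rw [mul_zero] at hlim
  exact hc (tendsto_nhds_unique hvc hlim)

end Ioi

/-! ## §3 The component `(−∞, −λ)` -/

section Iio

/-- **A solution regular at `(−λ)⁻`** on `(−∞, −λ)` with non-trivial data at `x₀ = −λ − 1/2`.
[cite: ConnesMoscovici2022, Lemma 1.1 (= arXiv:2112.05500 Lemma 2.1, chunk p0004:L39–L48); §1 (1.19)] -/
theorem exists_sol_Iio_tendsto_zero (hlam : 0 < lam) (z : ℂ) :
    ∃ v v' : ℝ → ℂ, (∀ x ∈ Iio (-lam), HasDerivAt v (v' x) x ∧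
        HasDerivAt (fun y ↦ pCoeff lam y * v' y) ((qCoeff lam x - z) * v x) x) ∧
      Tendsto (fun x ↦ pCoeff lam x * v' x) (𝓝[<] (-lam)) (𝓝 0) ∧
      (v (-lam - 1 / 2) ≠ 0 ∨ pCoeff lam (-lam - 1 / 2) * v' (-lam - 1 / 2) ≠ 0) := by
  have hx₀ : -lam - 1 / 2 < -lam := by linarith
  obtain ⟨g₁, g₁', h10, h11, hs₁⟩ := exists_sol_Iio hlam z hx₀ 1 0
  obtain ⟨g₂, g₂', h20, h21, hs₂⟩ := exists_sol_Iio hlam z hx₀ 0 1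
  obtain ⟨⟨c₁, hc₁⟩, -, -⟩ := prolate_singularEndpoint_left hlam z (fun x hx ↦ (hs₁ x hx).1)
    (fun x hx ↦ (hs₁ x hx).2)
  obtain ⟨⟨c₂, hc₂⟩, -, -⟩ := prolate_singularEndpoint_left hlam z (fun x hx ↦ (hs₂ x hx).1)
    (fun x hx ↦ (hs₂ x hx).2)
  have hne : c₁ ≠ 0 ∨ c₂ ≠ 0 := by
    obtain ⟨w, w', hsw, c, hc, hwc⟩ := exists_sol_Iio_tendsto_ne_zero hlam z
    obtain ⟨hl₁, hl₂⟩ := sol_linear_comb (w (-lam - 1 / 2)) (pCoeff lam (-lam - 1 / 2) * w' (-lam - 1 / 2))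
      (fun x hx ↦ (hs₁ x hx).1) (fun x hx ↦ (hs₁ x hx).2)
      (fun x hx ↦ (hs₂ x hx).1) (fun x hx ↦ (hs₂ x hx).2)
    have hd0 : w (-lam - 1 / 2) = w (-lam - 1 / 2) * g₁ (-lam - 1 / 2) + pCoeff lam (-lam - 1 / 2) * w' (-lam - 1 / 2) * g₂ (-lam - 1 / 2) := by
      rw [h10, h20]; ring
    have hd1 : pCoeff lam (-lam - 1 / 2) * w' (-lam - 1 / 2) =
        pCoeff lam (-lam - 1 / 2) * (w (-lam - 1 / 2) * g₁' (-lam - 1 / 2) + pCoeff lam (-lam - 1 / 2) * w' (-lam - 1 / 2) * g₂' (-lam - 1 / 2)) := by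
      have e : pCoeff lam (-lam - 1 / 2) * (w (-lam - 1 / 2) * g₁' (-lam - 1 / 2) + pCoeff lam (-lam - 1 / 2) * w' (-lam - 1 / 2) * g₂' (-lam - 1 / 2)) =
          w (-lam - 1 / 2) * (pCoeff lam (-lam - 1 / 2) * g₁' (-lam - 1 / 2)) +
            pCoeff lam (-lam - 1 / 2) * w' (-lam - 1 / 2) * (pCoeff lam (-lam - 1 / 2) * g₂' (-lam - 1 / 2)) := by ring
      rw [e, h11, h21]; ring
    have heq := eqOn_of_sol_Iio hlam hx₀ (fun x hx ↦ (hsw x hx).1) (fun x hx ↦ (hsw x hx).2)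
      hl₁ hl₂ hd0 hd1
    set a : ℂ := w (-lam - 1 / 2) with ha
    set b : ℂ := pCoeff lam (-lam - 1 / 2) * w' (-lam - 1 / 2) with hb
    have hlim : Tendsto (fun x ↦ pCoeff lam x * w' x) (𝓝[<] (-lam)) (𝓝 (a * c₁ + b * c₂)) := by
      have h := (hc₁.const_mul a).add (hc₂.const_mul b)
      refine h.congr' ?_
      filter_upwards [self_mem_nhdsWithin] with x hx
      rw [heq.2 hx]; ring
    have hc' : a * c₁ + b * c₂ = c := tendsto_nhds_unique hlim hwc
    by_contra h0
    push Not at h0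
    rw [h0.1, h0.2] at hc'
    exact hc (by rw [← hc']; ring)
  obtain ⟨hu₁, hu₂⟩ := sol_linear_comb c₂ (-c₁) (fun x hx ↦ (hs₁ x hx).1) (fun x hx ↦ (hs₁ x hx).2)
    (fun x hx ↦ (hs₂ x hx).1) (fun x hx ↦ (hs₂ x hx).2)
  refine ⟨fun y ↦ c₂ * g₁ y + -c₁ * g₂ y, fun y ↦ c₂ * g₁' y + -c₁ * g₂' y,
    fun x hx ↦ ⟨hu₁ x hx, hu₂ x hx⟩, ?_, ?_⟩
  · have h := (hc₁.const_mul c₂).add (hc₂.const_mul (-c₁))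
    rw [show c₂ * c₁ + -c₁ * c₂ = 0 by ring] at h
    refine h.congr' (Eventually.of_forall fun x ↦ ?_)
    simp only; ring
  · simp only [h10, h20, mul_one, mul_zero, add_zero]
    rw [mul_add, ← mul_assoc, mul_comm (pCoeff lam _) c₂, mul_assoc, h11, ← mul_assoc,
      mul_comm (pCoeff lam _) (-c₁), mul_assoc, h21]
    simp only [mul_zero, zero_add, mul_one, ne_eq, neg_eq_zero]
    tauto

/-- **The Green pair on `(−∞, −λ)`.**  Classical solution pairs `(u, u′)`, `(v, v′)` on `(−∞, −λ)`
with `v` REGULAR at `(−λ)⁻`, `u` of non-zero logarithmic coefficient there, and constant non-zero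
Wronskian `u (p v′) − v (p u′) ≡ ω`. [cite: ConnesMoscovici2022, Lemma 1.1 and Thm 1.6 (iv) (= arXiv:2112.05500 Lemma 2.1, Thm 2.6 (iv), chunks p0004:L39–L48, p0006:L79); §1 (1.5)–(1.6)] -/
theorem exists_greenPair_Iio (hlam : 0 < lam) (z : ℂ) :
    ∃ u u' v v' : ℝ → ℂ, ∃ ω c : ℂ, ω ≠ 0 ∧ c ≠ 0 ∧
      (∀ x ∈ Iio (-lam), HasDerivAt u (u' x) x ∧
        HasDerivAt (fun y ↦ pCoeff lam y * u' y) ((qCoeff lam x - z) * u x) x) ∧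
      (∀ x ∈ Iio (-lam), HasDerivAt v (v' x) x ∧
        HasDerivAt (fun y ↦ pCoeff lam y * v' y) ((qCoeff lam x - z) * v x) x) ∧
      Tendsto (fun x ↦ pCoeff lam x * v' x) (𝓝[<] (-lam)) (𝓝 0) ∧
      Tendsto (fun x ↦ pCoeff lam x * u' x) (𝓝[<] (-lam)) (𝓝 c) ∧
      ∀ x ∈ Iio (-lam), u x * (pCoeff lam x * v' x) - v x * (pCoeff lam x * u' x) = ω := by
  obtain ⟨v, v', hsv, hv0, hvne⟩ := exists_sol_Iio_tendsto_zero hlam z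
  obtain ⟨u, u', hsu, c, hc, huc⟩ := exists_sol_Iio_tendsto_ne_zero hlam z
  set x₀ : ℝ := -lam - 1 / 2 with hx₀def
  have hx₀ : x₀ < -lam := by rw [hx₀def]; linarith
  set ω : ℂ := u x₀ * (pCoeff lam x₀ * v' x₀) - v x₀ * (pCoeff lam x₀ * u' x₀) with hω
  have hW : ∀ x ∈ Iio (-lam), u x * (pCoeff lam x * v' x) - v x * (pCoeff lam x * u' x) = ω := by
    intro x hx
    set a : ℝ := min x x₀ - 1
    have hsub : Ioo a (-lam) ⊆ Iio (-lam) := fun y hy ↦ hy.2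
    have hxb : x ∈ Ioo a (-lam) := ⟨by simp only [a]; linarith [min_le_left x x₀], hx⟩
    have hx₀b : x₀ ∈ Ioo a (-lam) := ⟨by simp only [a]; linarith [min_le_right x x₀], hx₀⟩
    exact wronskian_sol_eq (fun y hy ↦ (hsu y (hsub hy)).1) (fun y hy ↦ (hsu y (hsub hy)).2)
      (fun y hy ↦ (hsv y (hsub hy)).1) (fun y hy ↦ (hsv y (hsub hy)).2) hxb hx₀b
  refine ⟨u, u', v, v', ω, c, ?_, hc, hsu, hsv, hv0, huc, hW⟩
  intro hω0
  -- `ω = 0`: `u = t v` (the data of `v` at `x₀` are non-trivial), so the coefficient of `u` vanishes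
  obtain ⟨t, hta, htb⟩ := exists_smul_of_det_eq_zero (a₁ := v x₀) (b₁ := pCoeff lam x₀ * v' x₀)
    (a₂ := u x₀) (b₂ := pCoeff lam x₀ * u' x₀) (by rw [hω] at hω0; linear_combination -hω0) hvne
  obtain ⟨hl₁, hl₂⟩ := sol_linear_comb t 0 (fun x hx ↦ (hsv x hx).1) (fun x hx ↦ (hsv x hx).2)
    (fun x hx ↦ (hsv x hx).1) (fun x hx ↦ (hsv x hx).2)
  have hd0 : u x₀ = t * v x₀ + 0 * v x₀ := by rw [hta]; ring
  have hd1 : pCoeff lam x₀ * u' x₀ = pCoeff lam x₀ * (t * v' x₀ + 0 * v' x₀) := by rw [htb]; ring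
  have heq := eqOn_of_sol_Iio hlam hx₀ (fun x hx ↦ (hsu x hx).1) (fun x hx ↦ (hsu x hx).2) hl₁ hl₂
    hd0 hd1
  have hlim : Tendsto (fun x ↦ pCoeff lam x * u' x) (𝓝[<] (-lam)) (𝓝 (t * 0)) := by
    refine (hv0.const_mul t).congr' ?_
    filter_upwards [self_mem_nhdsWithin] with x hx
    rw [heq.2 hx]; ring
  rw [mul_zero] at hlim
  exact hc (tendsto_nhds_unique huc hlim)

end Iio

/-! ## §4 The middle component `(−λ, λ)`: no solution is regular at both ends when `Im z ≠ 0` -/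

section Ioo

/-- Coefficient bound on the middle component: `‖q(x) − z‖ ≤ (2πλ)²λ² + ‖z‖` for `|x| < λ`.
[cite: ConnesMoscovici2022, §1 eq. (1.1) (= arXiv (2.1), chunk p0004:L5–L9)] -/
private theorem q_sub_bound_mid (lam : ℝ) (z : ℂ) {x : ℝ} (hx : x ∈ Ioo (-lam) lam) :
    ‖qCoeff lam x - z‖ ≤ (2 * π * lam) ^ 2 * lam ^ 2 + ‖z‖ := by
  have hq : ‖qCoeff lam x‖ = (2 * π * lam) ^ 2 * x ^ 2 := by
    rw [qCoeff, Complex.norm_real, Real.norm_eq_abs, abs_of_nonneg (by positivity)]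
  have hx2 : x ^ 2 ≤ lam ^ 2 := by nlinarith [hx.1, hx.2]
  calc ‖qCoeff lam x - z‖ ≤ ‖qCoeff lam x‖ + ‖z‖ := norm_sub_le _ _
    _ ≤ (2 * π * lam) ^ 2 * lam ^ 2 + ‖z‖ := by rw [hq]; gcongr

/-- `‖p(x)‖ = λ² − x²` on `(−λ, λ)`. [cite: ConnesMoscovici2022, §1 eq. (1.1) (= arXiv (2.1), chunk p0004:L5–L9)] -/
private theorem norm_pCoeff_mid {x : ℝ} (hx : x ∈ Ioo (-lam) lam) :
    ‖pCoeff lam x‖ = lam ^ 2 - x ^ 2 := by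
  have h : 0 ≤ lam ^ 2 - x ^ 2 := by nlinarith [hx.1, hx.2]
  rw [pCoeff, Complex.norm_real, Real.norm_eq_abs, abs_of_nonneg h]

/-- `‖p(x)‖ ≥ λ(λ − x)` on `(0, λ)`. [cite: ConnesMoscovici2022, §1 eq. (1.1) (= arXiv (2.1), chunk p0004:L5–L9)] -/
private theorem p_bound_mid_right {x : ℝ} (hx : x ∈ Ioo 0 lam) :
    lam * (lam - x) ≤ ‖pCoeff lam x‖ := by
  rw [norm_pCoeff_mid ⟨by linarith [hx.1, hx.2], hx.2⟩]
  nlinarith [hx.1, hx.2]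

/-- `‖p(x)‖ ≥ λ(x + λ)` on `(−λ, 0)`. [cite: ConnesMoscovici2022, §1 eq. (1.1) (= arXiv (2.1), chunk p0004:L5–L9)] -/
private theorem p_bound_mid_left {x : ℝ} (hx : x ∈ Ioo (-lam) 0) :
    lam * (x - -lam) ≤ ‖pCoeff lam x‖ := by
  rw [norm_pCoeff_mid ⟨hx.1, by linarith [hx.1, hx.2]⟩]
  nlinarith [hx.1, hx.2]

/-- Continuity of `q − z` and `p`. [cite: ConnesMoscovici2022, §1 eq. (1.1) (= arXiv (2.1), chunk p0004:L5–L9)] -/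
private theorem continuousOn_q_sub_and_p (lam : ℝ) (z : ℂ) (s : Set ℝ) :
    ContinuousOn (fun x ↦ qCoeff lam x - z) s ∧ ContinuousOn (pCoeff lam) s :=
  ⟨((continuous_qCoeff_def lam).continuousOn).sub continuousOn_const,
    (continuous_pCoeff_def lam).continuousOn⟩

/-- A solution on `(−λ, λ)` with `(λ² − x²) g′ → 0` at `λ⁻` has a finite limit there.
[cite: ConnesMoscovici2022, Lemma 1.1 (= arXiv:2112.05500 Lemma 2.1, chunk p0004:L39–L48); Cor 1.7 (i)] -/
theorem exists_tendsto_mid_right (hlam : 0 < lam) (z : ℂ) {g g' : ℝ → ℂ}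
    (hg : ∀ x ∈ Ioo (-lam) lam, HasDerivAt g (g' x) x)
    (hu : ∀ x ∈ Ioo (-lam) lam, HasDerivAt (fun y ↦ pCoeff lam y * g' y) ((qCoeff lam x - z) * g x) x)
    (h0 : Tendsto (fun x ↦ pCoeff lam x * g' x) (𝓝[<] lam) (𝓝 0)) :
    ∃ ℓ : ℂ, Tendsto g (𝓝[<] lam) (𝓝 ℓ) := by
  have hsub : Ioo 0 lam ⊆ Ioo (-lam) lam := fun x hx ↦ ⟨by linarith [hx.1], hx.2⟩
  exact exists_tendsto_of_singularEndpoint_left (P := pCoeff lam) (r := fun x ↦ qCoeff lam x - z)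
    (Q := (2 * π * lam) ^ 2 * lam ^ 2 + ‖z‖) hlam hlam
    (fun x hx ↦ hg x (hsub hx)) (fun x hx ↦ hu x (hsub hx))
    (continuousOn_q_sub_and_p lam z _).1 (fun x hx ↦ q_sub_bound_mid lam z (hsub hx))
    (continuousOn_q_sub_and_p lam z _).2 (fun x hx ↦ p_bound_mid_right hx) h0

/-- A solution on `(−λ, λ)` with `(λ² − x²) g′ → 0` at `(−λ)⁺` has a finite limit there.
[cite: ConnesMoscovici2022, Lemma 1.1 (= arXiv:2112.05500 Lemma 2.1, chunk p0004:L39–L48); Cor 1.7 (i)] -/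
theorem exists_tendsto_mid_left (hlam : 0 < lam) (z : ℂ) {g g' : ℝ → ℂ}
    (hg : ∀ x ∈ Ioo (-lam) lam, HasDerivAt g (g' x) x)
    (hu : ∀ x ∈ Ioo (-lam) lam, HasDerivAt (fun y ↦ pCoeff lam y * g' y) ((qCoeff lam x - z) * g x) x)
    (h0 : Tendsto (fun x ↦ pCoeff lam x * g' x) (𝓝[>] (-lam)) (𝓝 0)) :
    ∃ ℓ : ℂ, Tendsto g (𝓝[>] (-lam)) (𝓝 ℓ) := by
  have hsub : Ioo (-lam) 0 ⊆ Ioo (-lam) lam := fun x hx ↦ ⟨hx.1, by linarith [hx.2]⟩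
  exact exists_tendsto_of_singularEndpoint_right (P := pCoeff lam) (r := fun x ↦ qCoeff lam x - z)
    (Q := (2 * π * lam) ^ 2 * lam ^ 2 + ‖z‖) (by linarith) hlam
    (fun x hx ↦ hg x (hsub hx)) (fun x hx ↦ hu x (hsub hx))
    (continuousOn_q_sub_and_p lam z _).1 (fun x hx ↦ q_sub_bound_mid lam z (hsub hx))
    (continuousOn_q_sub_and_p lam z _).2 (fun x hx ↦ p_bound_mid_left hx) h0

/-- **Green's formula for `ḡ · (p g′)`, imaginary part.**  Along a solution pair on `(−λ, λ)` and
`−λ < x ≤ y < λ`:  `Im (ḡ(y) p(y) g′(y)) − Im (ḡ(x) p(x) g′(x)) = −Im z · ∫_x^y |g|²`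
(`d/dx (ḡ · p g′) = p |g′|² + (q − z)|g|²`, and `p`, `q` are real).
[cite: ConnesMoscovici2022, §1 eqs. (1.5)–(1.6) (= arXiv:2112.05500 (2.5)–(2.6), chunk p0005:L24–L31)] -/
theorem im_conj_mul_pDeriv_sub (z : ℂ) {g g' : ℝ → ℂ}
    (hg : ∀ x ∈ Ioo (-lam) lam, HasDerivAt g (g' x) x)
    (hu : ∀ x ∈ Ioo (-lam) lam, HasDerivAt (fun y ↦ pCoeff lam y * g' y) ((qCoeff lam x - z) * g x) x)
    {x y : ℝ} (hx : -lam < x) (hxy : x ≤ y) (hy : y < lam) :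
    (conj (g y) * (pCoeff lam y * g' y)).im - (conj (g x) * (pCoeff lam x * g' x)).im =
      -z.im * ∫ t in x..y, ‖g t‖ ^ 2 := by
  have hsub : Icc x y ⊆ Ioo (-lam) lam := fun t ht ↦ ⟨lt_of_lt_of_le hx ht.1, lt_of_le_of_lt ht.2 hy⟩
  set Φ : ℝ → ℂ := fun t ↦ conj (g t) * (pCoeff lam t * g' t) with hΦ
  set Φ' : ℝ → ℂ := fun t ↦ conj (g' t) * (pCoeff lam t * g' t) + conj (g t) * ((qCoeff lam t - z) * g t)
  have hd : ∀ t ∈ Icc x y, HasDerivAt Φ (Φ' t) t := by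
    intro t ht
    have h1 : HasDerivAt (fun s ↦ conj (g s)) (conj (g' t)) t := (hg t (hsub ht)).star
    exact h1.mul (hu t (hsub ht))
  -- continuity of the derivative on `[x, y]`
  have hgc : ContinuousOn g (Icc x y) := fun t ht ↦ (hg t (hsub ht)).continuousAt.continuousWithinAt
  have hpg'c : ContinuousOn (fun t ↦ pCoeff lam t * g' t) (Icc x y) := fun t ht ↦
    (hu t (hsub ht)).continuousAt.continuousWithinAt
  have hp0 : ∀ t ∈ Icc x y, pCoeff lam t ≠ 0 := fun t ht ↦
    pCoeff_ne_zero_iff.2 (Ioo_subset_setOf_ne_ne lam (hsub ht))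
  have hg'c : ContinuousOn g' (Icc x y) := by
    have h := (hpg'c.div (continuous_pCoeff_def lam).continuousOn hp0)
    refine h.congr fun t ht ↦ ?_
    simp only [Pi.div_apply]
    rw [mul_div_cancel_left₀ _ (hp0 t ht)]
  have hΦ'c : ContinuousOn Φ' (Icc x y) := by
    refine ((hg'c.star).mul hpg'c).add ((hgc.star).mul ?_)
    exact (((continuous_qCoeff_def lam).continuousOn.sub continuousOn_const).mul hgc)
  have hint : IntervalIntegrable Φ' volume x y :=
    (hΦ'c.mono (by rw [uIcc_of_le hxy])).intervalIntegrable
  have hFTC : ∫ t in x..y, Φ' t = Φ y - Φ x :=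
    intervalIntegral.integral_eq_sub_of_hasDerivAt (fun t ht ↦ hd t (by rwa [uIcc_of_le hxy] at ht)) hint
  -- imaginary parts: `Im Φ′ = −Im z |g|²`
  have him : ∀ t ∈ Icc x y, (Φ' t).im = -z.im * ‖g t‖ ^ 2 := by
    intro t _
    have e : Φ' t = pCoeff lam t * ((‖g' t‖ ^ 2 : ℝ) : ℂ) + (qCoeff lam t - z) * ((‖g t‖ ^ 2 : ℝ) : ℂ) := by
      have h1 : conj (g' t) * g' t = ((‖g' t‖ ^ 2 : ℝ) : ℂ) := by
        rw [Complex.conj_mul']; push_cast; ring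
      have h2 : conj (g t) * g t = ((‖g t‖ ^ 2 : ℝ) : ℂ) := by
        rw [Complex.conj_mul']; push_cast; ring
      simp only [Φ']
      rw [← h1, ← h2]; ring
    rw [e]
    simp only [pCoeff, qCoeff, Complex.add_im, Complex.mul_im, Complex.ofReal_re, Complex.ofReal_im,
      Complex.sub_re, Complex.sub_im, mul_zero, zero_mul, add_zero, zero_add, zero_sub]
  have hre : (∫ t in x..y, Φ' t).im = ∫ t in x..y, (Φ' t).im := by
    have := (Complex.imCLM.intervalIntegral_comp_comm hint)
    simpa using this.symm
  have h3 : ∫ t in x..y, (Φ' t).im = -z.im * ∫ t in x..y, ‖g t‖ ^ 2 := by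
    rw [← intervalIntegral.integral_const_mul]
    refine intervalIntegral.integral_congr fun t ht ↦ ?_
    exact him t (by rwa [uIcc_of_le hxy] at ht)
  have := congrArg Complex.im hFTC
  rw [hre, h3, Complex.sub_im] at this
  simpa [hΦ] using this.symm

/-- **No solution on `(−λ, λ)` is regular at both `±λ` when `Im z ≠ 0`** (the Legendre-type prolate
operator on `[−λ, λ]` with the boundary condition (1.19) is symmetric, so it has no non-real
eigenvalue): if `(λ² − x²) g′(x) → 0` both as `x → λ⁻` and as `x → (−λ)⁺`, then `g ≡ 0` on `(−λ, λ)`.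
Proof: `g` is bounded near both ends (finite limits), so `ḡ · p g′ → 0` there; the imaginary part of
Green's formula gives `Im z ∫_{−λ}^{λ} |g|² = 0`.
[cite: ConnesMoscovici2022, Thm 1.6 (i),(iv) (= arXiv:2112.05500 Thm 2.6, chunk p0006:L76–L114); §1 eqs. (1.5)–(1.6), (1.19)] -/
theorem sol_Ioo_eq_zero_of_tendsto_zero (hlam : 0 < lam) (hz : z.im ≠ 0) {g g' : ℝ → ℂ}
    (hg : ∀ x ∈ Ioo (-lam) lam, HasDerivAt g (g' x) x)
    (hu : ∀ x ∈ Ioo (-lam) lam, HasDerivAt (fun y ↦ pCoeff lam y * g' y) ((qCoeff lam x - z) * g x) x)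
    (hR : Tendsto (fun x ↦ pCoeff lam x * g' x) (𝓝[<] lam) (𝓝 0))
    (hL : Tendsto (fun x ↦ pCoeff lam x * g' x) (𝓝[>] (-lam)) (𝓝 0)) :
    ∀ x ∈ Ioo (-lam) lam, g x = 0 := by
  obtain ⟨ℓR, hℓR⟩ := exists_tendsto_mid_right hlam z hg hu hR
  obtain ⟨ℓL, hℓL⟩ := exists_tendsto_mid_left hlam z hg hu hL
  -- the boundary term `Φ = ḡ · p g′` tends to `0` at both ends
  set Φ : ℝ → ℂ := fun t ↦ conj (g t) * (pCoeff lam t * g' t) with hΦ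
  have hΦR : Tendsto Φ (𝓝[<] lam) (𝓝 0) := by
    have h := (hℓR.star).mul hR
    rw [mul_zero] at h
    exact h
  have hΦL : Tendsto Φ (𝓝[>] (-lam)) (𝓝 0) := by
    have h := (hℓL.star).mul hL
    rw [mul_zero] at h
    exact h
  -- `g ∈ L²(−λ, λ)`
  have hL2 : IntegrableOn (fun x ↦ ‖g x‖ ^ 2) (Ioo (-lam) lam) := prolate_sq_integrableOn_mid hlam z hg hu
  have hll : -lam < lam := by linarith
  have hi : IntervalIntegrable (fun t ↦ ‖g t‖ ^ 2) volume (-lam) lam :=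
    (intervalIntegrable_iff_integrableOn_Ioo_of_le hll.le).2 hL2
  have h0mem : (0 : ℝ) ∈ Ioo (-lam) lam := ⟨by linarith, hlam⟩
  -- the identity `Im z · ∫_0^y |g|² = Im Φ(0) − Im Φ(y)` on `(−λ, λ)`
  have key : ∀ x ∈ Ioo (-lam) lam, ∀ y ∈ Ioo (-lam) lam, x ≤ y →
      (Φ y).im = (Φ x).im - z.im * ∫ t in x..y, ‖g t‖ ^ 2 := by
    intro x hx y hy hxy
    have h := im_conj_mul_pDeriv_sub z hg hu hx.1 hxy hy.2
    simp only [hΦ]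
    linear_combination h
  set P : ℝ → ℝ := fun y ↦ ∫ t in (0 : ℝ)..y, ‖g t‖ ^ 2 with hP
  have hFy : ∀ y ∈ Ioo (-lam) lam, z.im * P y = (Φ 0).im - (Φ y).im := by
    intro y hy
    rcases le_total 0 y with h0y | hy0
    · have := key 0 h0mem y hy h0y
      simp only [hP]; linarith
    · have := key y hy 0 h0mem hy0
      simp only [hP]
      rw [intervalIntegral.integral_symm]; linarith
  -- continuity of the primitive on `[−λ, λ]`
  have hPc : ContinuousOn P (Icc (-lam) lam) := by
    have := intervalIntegral.continuousOn_primitive_interval' hi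
      (by rw [uIcc_of_le hll.le]; exact ⟨by linarith, hlam.le⟩ : (0 : ℝ) ∈ uIcc (-lam) lam)
    rwa [uIcc_of_le hll.le] at this
  have hPR : Tendsto P (𝓝[<] lam) (𝓝 (P lam)) := by
    rw [← nhdsWithin_Ioo_eq_nhdsLT hll]
    exact ((hPc lam (right_mem_Icc.2 hll.le)).mono Ioo_subset_Icc_self).tendsto
  have hPL : Tendsto P (𝓝[>] (-lam)) (𝓝 (P (-lam))) := by
    rw [← nhdsWithin_Ioo_eq_nhdsGT hll]
    exact ((hPc (-lam) (left_mem_Icc.2 hll.le)).mono Ioo_subset_Icc_self).tendsto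
  -- pass to the limits in `hFy`
  have hevR : ∀ᶠ y in 𝓝[<] lam, z.im * P y = (Φ 0).im - (Φ y).im := by
    rw [← nhdsWithin_Ioo_eq_nhdsLT hll]
    filter_upwards [self_mem_nhdsWithin] with y hy using hFy y hy
  have hevL : ∀ᶠ y in 𝓝[>] (-lam), z.im * P y = (Φ 0).im - (Φ y).im := by
    rw [← nhdsWithin_Ioo_eq_nhdsGT hll]
    filter_upwards [self_mem_nhdsWithin] with y hy using hFy y hy
  have hΦR0 : Tendsto (fun y ↦ (Φ y).im) (𝓝[<] lam) (𝓝 0) := by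
    have h := (Complex.continuous_im.tendsto 0).comp hΦR
    rw [Complex.zero_im] at h
    exact h
  have hΦL0 : Tendsto (fun y ↦ (Φ y).im) (𝓝[>] (-lam)) (𝓝 0) := by
    have h := (Complex.continuous_im.tendsto 0).comp hΦL
    rw [Complex.zero_im] at h
    exact h
  have hΦRim : Tendsto (fun y ↦ (Φ 0).im - (Φ y).im) (𝓝[<] lam) (𝓝 ((Φ 0).im - 0)) :=
    tendsto_const_nhds.sub hΦR0
  have hΦLim : Tendsto (fun y ↦ (Φ 0).im - (Φ y).im) (𝓝[>] (-lam)) (𝓝 ((Φ 0).im - 0)) :=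
    tendsto_const_nhds.sub hΦL0
  have hR' : z.im * P lam = (Φ 0).im - 0 :=
    tendsto_nhds_unique ((hPR.const_mul z.im).congr' hevR) hΦRim
  have hL' : z.im * P (-lam) = (Φ 0).im - 0 :=
    tendsto_nhds_unique ((hPL.const_mul z.im).congr' hevL) hΦLim
  have hPeq : P lam = P (-lam) := mul_left_cancel₀ hz (hR'.trans hL'.symm)
  -- `P λ = ∫_0^λ |g|² ≥ 0` and `P(−λ) = −∫_{−λ}^0 |g|² ≤ 0`
  have hP1 : 0 ≤ P lam := intervalIntegral.integral_nonneg hlam.le fun t _ ↦ by positivity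
  have hP2 : P (-lam) = -∫ t in (-lam)..0, ‖g t‖ ^ 2 := by
    simp only [hP]; rw [intervalIntegral.integral_symm]
  have hP3 : 0 ≤ ∫ t in (-lam)..0, ‖g t‖ ^ 2 :=
    intervalIntegral.integral_nonneg (by linarith) fun t _ ↦ by positivity
  have hi1 : IntervalIntegrable (fun t ↦ ‖g t‖ ^ 2) volume (-lam) 0 :=
    (intervalIntegrable_iff_integrableOn_Ioo_of_le (by linarith : -lam ≤ 0)).2
      (hL2.mono_set (Ioo_subset_Ioo_right hlam.le))
  have hi2 : IntervalIntegrable (fun t ↦ ‖g t‖ ^ 2) volume 0 lam :=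
    (intervalIntegrable_iff_integrableOn_Ioo_of_le hlam.le).2
      (hL2.mono_set (Ioo_subset_Ioo_left (by linarith)))
  have hI0 : ∫ t in (-lam)..lam, ‖g t‖ ^ 2 = 0 := by
    rw [← intervalIntegral.integral_add_adjacent_intervals hi1 hi2]
    change (∫ t in (-lam)..0, ‖g t‖ ^ 2) + P lam = 0
    linarith
  -- hence `|g|² = 0` a.e. on `(−λ, λ)`, and `g ≡ 0` there by continuity
  have hI0' : ∫ t in Ioo (-lam) lam, ‖g t‖ ^ 2 = 0 := by
    rw [← integral_Ioc_eq_integral_Ioo, ← intervalIntegral.integral_of_le hll.le]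
    exact hI0
  have hae : (fun t ↦ ‖g t‖ ^ 2) =ᵐ[volume.restrict (Ioo (-lam) lam)] 0 :=
    (setIntegral_eq_zero_iff_of_nonneg_ae (Eventually.of_forall fun t ↦ by positivity) hL2).1 hI0'
  have hgc : ContinuousOn g (Ioo (-lam) lam) := fun x hx ↦ (hg x hx).continuousAt.continuousWithinAt
  have hEq : EqOn (fun t ↦ ‖g t‖ ^ 2) (fun _ ↦ (0 : ℝ)) (Ioo (-lam) lam) :=
    Measure.eqOn_Ioo_of_ae_eq (μ := volume) hae (hgc.norm.pow 2) continuousOn_const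
  intro x hx
  have := hEq hx
  simpa using this

/-- **A solution regular at `λ⁻` on the middle component**, with non-trivial data at `0`.
[cite: ConnesMoscovici2022, Lemma 1.1 (= arXiv:2112.05500 Lemma 2.1, chunk p0004:L39–L48); §1 (1.19)] -/
theorem exists_sol_Ioo_tendsto_zero_right (hlam : 0 < lam) (z : ℂ) :
    ∃ v v' : ℝ → ℂ, (∀ x ∈ Ioo (-lam) lam, HasDerivAt v (v' x) x ∧
        HasDerivAt (fun y ↦ pCoeff lam y * v' y) ((qCoeff lam x - z) * v x) x) ∧
      Tendsto (fun x ↦ pCoeff lam x * v' x) (𝓝[<] lam) (𝓝 0) ∧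
      (v 0 ≠ 0 ∨ pCoeff lam 0 * v' 0 ≠ 0) := by
  have hx₀ : (0 : ℝ) ∈ Ioo (-lam) lam := ⟨by linarith, hlam⟩
  obtain ⟨g₁, g₁', h10, h11, hs₁⟩ := exists_sol_Ioo z hx₀ 1 0
  obtain ⟨g₂, g₂', h20, h21, hs₂⟩ := exists_sol_Ioo z hx₀ 0 1
  obtain ⟨⟨c₁, hc₁⟩, -, -⟩ := prolate_singularEndpoint_mid_right hlam z (fun x hx ↦ (hs₁ x hx).1)
    (fun x hx ↦ (hs₁ x hx).2)
  obtain ⟨⟨c₂, hc₂⟩, -, -⟩ := prolate_singularEndpoint_mid_right hlam z (fun x hx ↦ (hs₂ x hx).1)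
    (fun x hx ↦ (hs₂ x hx).2)
  have hne : c₁ ≠ 0 ∨ c₂ ≠ 0 := by
    obtain ⟨w, w', hsw, c, hc, hwc⟩ := exists_sol_Ioo_tendsto_ne_zero_right hlam z
    obtain ⟨hl₁, hl₂⟩ := sol_linear_comb (w 0) (pCoeff lam 0 * w' 0)
      (fun x hx ↦ (hs₁ x hx).1) (fun x hx ↦ (hs₁ x hx).2)
      (fun x hx ↦ (hs₂ x hx).1) (fun x hx ↦ (hs₂ x hx).2)
    have hd0 : w 0 = w 0 * g₁ 0 + pCoeff lam 0 * w' 0 * g₂ 0 := by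
      rw [h10, h20]; ring
    have hd1 : pCoeff lam 0 * w' 0 = pCoeff lam 0 * (w 0 * g₁' 0 + pCoeff lam 0 * w' 0 * g₂' 0) := by
      have e : pCoeff lam 0 * (w 0 * g₁' 0 + pCoeff lam 0 * w' 0 * g₂' 0) =
          w 0 * (pCoeff lam 0 * g₁' 0) + pCoeff lam 0 * w' 0 * (pCoeff lam 0 * g₂' 0) := by ring
      rw [e, h11, h21]; ring
    have heq := eqOn_of_sol_Ioo (Ioo_subset_setOf_ne_ne lam) hx₀ (fun x hx ↦ (hsw x hx).1)
      (fun x hx ↦ (hsw x hx).2) hl₁ hl₂ hd0 hd1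
    set a : ℂ := w 0 with ha
    set b : ℂ := pCoeff lam 0 * w' 0 with hb
    have hlim : Tendsto (fun x ↦ pCoeff lam x * w' x) (𝓝[<] lam) (𝓝 (a * c₁ + b * c₂)) := by
      have h := (hc₁.const_mul a).add (hc₂.const_mul b)
      refine h.congr' ?_
      rw [← nhdsWithin_Ioo_eq_nhdsLT (by linarith : -lam < lam)]
      filter_upwards [self_mem_nhdsWithin] with x hx
      rw [heq.2 hx]; ring
    have hc' : a * c₁ + b * c₂ = c := tendsto_nhds_unique hlim hwc
    by_contra h0
    push Not at h0
    rw [h0.1, h0.2] at hc'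
    exact hc (by rw [← hc']; ring)
  obtain ⟨hu₁, hu₂⟩ := sol_linear_comb c₂ (-c₁) (fun x hx ↦ (hs₁ x hx).1) (fun x hx ↦ (hs₁ x hx).2)
    (fun x hx ↦ (hs₂ x hx).1) (fun x hx ↦ (hs₂ x hx).2)
  refine ⟨fun y ↦ c₂ * g₁ y + -c₁ * g₂ y, fun y ↦ c₂ * g₁' y + -c₁ * g₂' y,
    fun x hx ↦ ⟨hu₁ x hx, hu₂ x hx⟩, ?_, ?_⟩
  · have h := (hc₁.const_mul c₂).add (hc₂.const_mul (-c₁))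
    rw [show c₂ * c₁ + -c₁ * c₂ = 0 by ring] at h
    refine h.congr' (Eventually.of_forall fun x ↦ ?_)
    simp only; ring
  · simp only [h10, h20, mul_one, mul_zero, add_zero]
    rw [mul_add, ← mul_assoc, mul_comm (pCoeff lam _) c₂, mul_assoc, h11, ← mul_assoc,
      mul_comm (pCoeff lam _) (-c₁), mul_assoc, h21]
    simp only [mul_zero, zero_add, mul_one, ne_eq, neg_eq_zero]
    tauto

/-- **A solution regular at `(−λ)⁺` on the middle component**, with non-trivial data at `0`.
[cite: ConnesMoscovici2022, Lemma 1.1 (= arXiv:2112.05500 Lemma 2.1, chunk p0004:L39–L48); §1 (1.19)] -/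
theorem exists_sol_Ioo_tendsto_zero_left (hlam : 0 < lam) (z : ℂ) :
    ∃ u u' : ℝ → ℂ, (∀ x ∈ Ioo (-lam) lam, HasDerivAt u (u' x) x ∧
        HasDerivAt (fun y ↦ pCoeff lam y * u' y) ((qCoeff lam x - z) * u x) x) ∧
      Tendsto (fun x ↦ pCoeff lam x * u' x) (𝓝[>] (-lam)) (𝓝 0) ∧
      (u 0 ≠ 0 ∨ pCoeff lam 0 * u' 0 ≠ 0) := by
  have hx₀ : (0 : ℝ) ∈ Ioo (-lam) lam := ⟨by linarith, hlam⟩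
  obtain ⟨g₁, g₁', h10, h11, hs₁⟩ := exists_sol_Ioo z hx₀ 1 0
  obtain ⟨g₂, g₂', h20, h21, hs₂⟩ := exists_sol_Ioo z hx₀ 0 1
  obtain ⟨⟨c₁, hc₁⟩, -, -⟩ := prolate_singularEndpoint_mid_left hlam z (fun x hx ↦ (hs₁ x hx).1)
    (fun x hx ↦ (hs₁ x hx).2)
  obtain ⟨⟨c₂, hc₂⟩, -, -⟩ := prolate_singularEndpoint_mid_left hlam z (fun x hx ↦ (hs₂ x hx).1)
    (fun x hx ↦ (hs₂ x hx).2)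
  have hne : c₁ ≠ 0 ∨ c₂ ≠ 0 := by
    obtain ⟨w, w', hsw, c, hc, hwc⟩ := exists_sol_Ioo_tendsto_ne_zero_left hlam z
    obtain ⟨hl₁, hl₂⟩ := sol_linear_comb (w 0) (pCoeff lam 0 * w' 0)
      (fun x hx ↦ (hs₁ x hx).1) (fun x hx ↦ (hs₁ x hx).2)
      (fun x hx ↦ (hs₂ x hx).1) (fun x hx ↦ (hs₂ x hx).2)
    have hd0 : w 0 = w 0 * g₁ 0 + pCoeff lam 0 * w' 0 * g₂ 0 := by
      rw [h10, h20]; ring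
    have hd1 : pCoeff lam 0 * w' 0 = pCoeff lam 0 * (w 0 * g₁' 0 + pCoeff lam 0 * w' 0 * g₂' 0) := by
      have e : pCoeff lam 0 * (w 0 * g₁' 0 + pCoeff lam 0 * w' 0 * g₂' 0) =
          w 0 * (pCoeff lam 0 * g₁' 0) + pCoeff lam 0 * w' 0 * (pCoeff lam 0 * g₂' 0) := by ring
      rw [e, h11, h21]; ring
    have heq := eqOn_of_sol_Ioo (Ioo_subset_setOf_ne_ne lam) hx₀ (fun x hx ↦ (hsw x hx).1)
      (fun x hx ↦ (hsw x hx).2) hl₁ hl₂ hd0 hd1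
    set a : ℂ := w 0 with ha
    set b : ℂ := pCoeff lam 0 * w' 0 with hb
    have hlim : Tendsto (fun x ↦ pCoeff lam x * w' x) (𝓝[>] (-lam)) (𝓝 (a * c₁ + b * c₂)) := by
      have h := (hc₁.const_mul a).add (hc₂.const_mul b)
      refine h.congr' ?_
      rw [← nhdsWithin_Ioo_eq_nhdsGT (by linarith : -lam < lam)]
      filter_upwards [self_mem_nhdsWithin] with x hx
      rw [heq.2 hx]; ring
    have hc' : a * c₁ + b * c₂ = c := tendsto_nhds_unique hlim hwc
    by_contra h0
    push Not at h0
    rw [h0.1, h0.2] at hc'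
    exact hc (by rw [← hc']; ring)
  obtain ⟨hu₁, hu₂⟩ := sol_linear_comb c₂ (-c₁) (fun x hx ↦ (hs₁ x hx).1) (fun x hx ↦ (hs₁ x hx).2)
    (fun x hx ↦ (hs₂ x hx).1) (fun x hx ↦ (hs₂ x hx).2)
  refine ⟨fun y ↦ c₂ * g₁ y + -c₁ * g₂ y, fun y ↦ c₂ * g₁' y + -c₁ * g₂' y,
    fun x hx ↦ ⟨hu₁ x hx, hu₂ x hx⟩, ?_, ?_⟩
  · have h := (hc₁.const_mul c₂).add (hc₂.const_mul (-c₁))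
    rw [show c₂ * c₁ + -c₁ * c₂ = 0 by ring] at h
    refine h.congr' (Eventually.of_forall fun x ↦ ?_)
    simp only; ring
  · simp only [h10, h20, mul_one, mul_zero, add_zero]
    rw [mul_add, ← mul_assoc, mul_comm (pCoeff lam _) c₂, mul_assoc, h11, ← mul_assoc,
      mul_comm (pCoeff lam _) (-c₁), mul_assoc, h21]
    simp only [mul_zero, zero_add, mul_one, ne_eq, neg_eq_zero]
    tauto

/-- **The Green pair on `(−λ, λ)`** (`Im z ≠ 0`).  Classical solution pairs `(u, u′)`, `(v, v′)` on
`(−λ, λ)` with `u` regular at `(−λ)⁺`, `v` regular at `λ⁻`, and constant NON-ZERO Wronskian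
`u (p v′) − v (p u′) ≡ ω` (non-zero because by `sol_Ioo_eq_zero_of_tendsto_zero` no non-trivial
solution is regular at both ends).
[cite: ConnesMoscovici2022, Lemma 1.1 and Thm 1.6 (iv) (= arXiv:2112.05500 Lemma 2.1, Thm 2.6 (iv), chunks p0004:L39–L48, p0006:L79); §1 (1.5)–(1.6)] -/
theorem exists_greenPair_Ioo (hlam : 0 < lam) (hz : z.im ≠ 0) :
    ∃ u u' v v' : ℝ → ℂ, ∃ ω : ℂ, ω ≠ 0 ∧
      (∀ x ∈ Ioo (-lam) lam, HasDerivAt u (u' x) x ∧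
        HasDerivAt (fun y ↦ pCoeff lam y * u' y) ((qCoeff lam x - z) * u x) x) ∧
      (∀ x ∈ Ioo (-lam) lam, HasDerivAt v (v' x) x ∧
        HasDerivAt (fun y ↦ pCoeff lam y * v' y) ((qCoeff lam x - z) * v x) x) ∧
      Tendsto (fun x ↦ pCoeff lam x * u' x) (𝓝[>] (-lam)) (𝓝 0) ∧
      Tendsto (fun x ↦ pCoeff lam x * v' x) (𝓝[<] lam) (𝓝 0) ∧
      ∀ x ∈ Ioo (-lam) lam, u x * (pCoeff lam x * v' x) - v x * (pCoeff lam x * u' x) = ω := by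
  obtain ⟨u, u', hsu, hu0, hune⟩ := exists_sol_Ioo_tendsto_zero_left hlam z
  obtain ⟨v, v', hsv, hv0, hvne⟩ := exists_sol_Ioo_tendsto_zero_right hlam z
  have hx₀ : (0 : ℝ) ∈ Ioo (-lam) lam := ⟨by linarith, hlam⟩
  set ω : ℂ := u 0 * (pCoeff lam 0 * v' 0) - v 0 * (pCoeff lam 0 * u' 0) with hω
  have hW : ∀ x ∈ Ioo (-lam) lam, u x * (pCoeff lam x * v' x) - v x * (pCoeff lam x * u' x) = ω :=
    fun x hx ↦ wronskian_sol_eq (fun y hy ↦ (hsu y hy).1) (fun y hy ↦ (hsu y hy).2)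
      (fun y hy ↦ (hsv y hy).1) (fun y hy ↦ (hsv y hy).2) hx hx₀
  refine ⟨u, u', v, v', ω, ?_, hsu, hsv, hu0, hv0, hW⟩
  intro hω0
  -- `ω = 0`: `v = t u`, so `v` is regular at `(−λ)⁺` too, hence `v ≡ 0` — contradiction
  obtain ⟨t, hta, htb⟩ := exists_smul_of_det_eq_zero (a₁ := u 0) (b₁ := pCoeff lam 0 * u' 0)
    (a₂ := v 0) (b₂ := pCoeff lam 0 * v' 0) (by rw [hω] at hω0; exact hω0) hune
  obtain ⟨hl₁, hl₂⟩ := sol_linear_comb t 0 (fun x hx ↦ (hsu x hx).1) (fun x hx ↦ (hsu x hx).2)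
    (fun x hx ↦ (hsu x hx).1) (fun x hx ↦ (hsu x hx).2)
  have hd0 : v 0 = t * u 0 + 0 * u 0 := by rw [hta]; ring
  have hd1 : pCoeff lam 0 * v' 0 = pCoeff lam 0 * (t * u' 0 + 0 * u' 0) := by rw [htb]; ring
  have heq := eqOn_of_sol_Ioo (Ioo_subset_setOf_ne_ne lam) hx₀ (fun x hx ↦ (hsv x hx).1)
    (fun x hx ↦ (hsv x hx).2) hl₁ hl₂ hd0 hd1
  have hvL : Tendsto (fun x ↦ pCoeff lam x * v' x) (𝓝[>] (-lam)) (𝓝 (t * 0)) := by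
    refine (hu0.const_mul t).congr' ?_
    rw [← nhdsWithin_Ioo_eq_nhdsGT (by linarith : -lam < lam)]
    filter_upwards [self_mem_nhdsWithin] with x hx
    rw [heq.2 hx]; ring
  rw [mul_zero] at hvL
  have hv00 := sol_Ioo_eq_zero_of_tendsto_zero hlam hz (fun x hx ↦ (hsv x hx).1)
    (fun x hx ↦ (hsv x hx).2) hv0 hvL
  -- `v ≡ 0` on `(−λ, λ)` forces zero data at `0`
  have hv0' : v 0 = 0 := hv00 0 hx₀
  have hv'0 : v' 0 = 0 := by
    have hd : HasDerivAt v (v' 0) 0 := (hsv 0 hx₀).1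
    have hd0 : HasDerivAt v 0 0 := by
      refine (hasDerivAt_const (0 : ℝ) (0 : ℂ)).congr_of_eventuallyEq ?_
      filter_upwards [Ioo_mem_nhds hx₀.1 hx₀.2] with x hx using hv00 x hx
    exact hd.unique hd0
  rcases hvne with h | h
  · exact h hv0'
  · exact h (by rw [hv'0, mul_zero])

end Ioo


end Literature.NumberTheory.ConnesMoscovici2022

end
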